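import Summits.CriticalPhenomena.PercolationContinuityZ3.Theorems.PercNearOneGluingNoHeavyLowerTailSahiIndependentPairJoin
import Literature.Combinatorics.Sahi2008.CumulationCone
import Literature.Combinatorics.Sahi2008.TotalOrder
import HarnessLib

/-!
# `NoHeavyLowerTail` (stmt-CriticalPhenomena-4575) — independent joins with the two classical PRODUCT-CLOSED Sahi classes:
# Sahi's cumulations (Theorem 2) and Blinovsky's chains; cylinder events ∪ width-≤5 hitting events on disjoint coordinates

Support file, seat `prim-l12-p5` (gen 13), `--supports stmt-CriticalPhenomena-4575`; COMPUTATIONAL only through the imported hitting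
`C₄/C₅` kernel certificates behind `…SahiHittingWidthFive` (Parts 1–2 use standard axioms).  No definitions, no named facts, no sorries.

## What is proved

The tree's "independent products preserve Sahi positivity of a multiplicatively closed class"
(`SahiIndependentProducts.sahiE_prodWeight_nonneg_of_classes`, seat prim-sahi-p2) needs, on the first factor, a class `𝒜 ∋ 1`
closed under products all of whose finite families have `E_m ≥ 0`.  The literature supplies exactly two such classes beyond
`|X| ≤ 2` (used in `…SahiIndependentPairJoin`):

* Sahi's CUMULATION CONE `𝒞[X]` on `2^X` under a product measure [Sahi2008, Thm. 2 (p. 211), Lemma 11 (p. 217): `𝒞` is closed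
  under products] — tree `sahi2008_thm2`, `IsCumulation.mul`;
* all nonnegative monotone functions on a finite CHAIN under any probability weight [Blinovsky 2013, Lemma 1] — tree
  `sahiPositive_of_linearOrder` (products of nonnegative monotone functions are nonnegative monotone).

Combined with the padding lemma `SahiIndependentPairJoin.sahiE_nonneg_of_forall_mem_insert_one` (a hereditarily positive class
stays so after adjoining the constant `1`) this gives, for ANY probability weight `ν` on a second factor `β` and ANY class `ℬ` of
functions on `β` all of whose finite families are Sahi-nonnegative:

* `sahiE_prodWeight_nonneg_of_cumulation_of_class` — under `(product measure on 2^X) ⊗ ν`, every family of products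
  `φ_i(T)ψ_i(y)` with `φ_i ∈ 𝒞[X]` and `ψ_i ∈ ℬ ∪ {1}` has `E_n ≥ 0`; union form `sahiE_prodWeight_cumulation_union_nonneg`
  (`k` cumulations read on the first factor followed by an `ℬ`-family read on the second, `Fin.append`);
* `sahiE_prodWeight_nonneg_of_chain_of_class`, `sahiE_prodWeight_chain_union_nonneg` — the same with a finite chain carrying an
  arbitrary probability weight and nonnegative monotone `φ_i` (e.g. functions of ONE coordinate of a product space, or of the
  number of open sites among exchangeable ones after conditioning).
* Percolation (`SahiHitting` vocabulary on the second factor): `prodWeight_sahiE_cylinder_union_hit_nonneg` — for two independent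
  product-Bernoulli models, the family of CYLINDER events "all sites of `S_1`", …, "all sites of `S_k` are open" (arbitrary
  `S_j ⊆ ι₁`, any multiplicities — indeed any cumulations) together with hitting events `H_{C_1}, …, H_{C_m}` of a width-≤5
  collection `C ⊆ 2^{ι₂}` is Sahi-nonnegative at EVERY order `k + m`; `…_of_card_le_five` for at most five `C`'s with
  multiplicities.  (Hitting events `H_A` with `|A| ≥ 2` are NOT cumulations — their Möbius coefficients alternate — which is why
  the second factor is needed.)
-/

namespace Summit.CriticalPhenomena.PercolationContinuityZ3.Theorems

namespace SahiIndependentClassJoin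

open Finset Function Literature.Combinatorics.Sahi2008
open Literature.Probability.Percolation.DecisionTree (ind ind_of_mem ind_of_not_mem ind_nonneg)
open SahiIndependentPairJoin (sahiE_nonneg_of_forall_mem_insert_one)

/-! ## Part 1.  Sahi's cumulation cone on the first factor -/

section Cumulation

variable {ι₁ : Type*} [DecidableEq ι₁] [Fintype ι₁] {β : Type*} [Fintype β]

omit [Fintype ι₁] in
/-- The constant function `1 = 1_{⊇ ∅}` is a cumulation. [cite: Sahi2008, p. 210] -/
theorem isCumulation_one : IsCumulation (1 : Finset ι₁ → ℝ) := by
  refine ⟨fun S => if S = ∅ then 1 else 0, fun S => ?_, fun T => ?_⟩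
  · show (0 : ℝ) ≤ (if S = ∅ then 1 else 0)
    split_ifs <;> norm_num
  · rw [Finset.sum_ite_eq' T.powerset ∅ (fun _ => (1 : ℝ)), if_pos (Finset.empty_mem_powerset T), Pi.one_apply]

/-- The cumulation cone is closed under the pointwise product of functions (Sahi's Lemma 11, `Pi` form).
[cite: Sahi2008, Lemma 11 (p. 217)] -/
theorem isCumulation_mul {g g' : Finset ι₁ → ℝ} (h : IsCumulation g) (h' : IsCumulation g') : IsCumulation (g * g') :=
  h.mul h'

/-- **Cumulations join independently to any hereditarily Sahi-positive class, at every order.**  `m : ι₁ → [0,1]` the parameters of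
a product measure on `2^{ι₁}`; `ν` a probability weight (total mass `1`) on `β`; `ℬ` a class of functions on `β` all of whose finite
families have `E_k ≥ 0` under `ν`.  Then under the product weight every family of products `φ_i(T)ψ_i(y)` with `φ_i ∈ 𝒞[ι₁]`
(cumulations) and `ψ_i ∈ ℬ ∪ {1}` has `E_n ≥ 0`. [cite: Sahi2008, Thm. 2 (p. 211), Lemma 11 (p. 217), Prop. 12 (p. 219)] -/
theorem sahiE_prodWeight_nonneg_of_cumulation_of_class (m : ι₁ → ℝ) (h0 : ∀ x, 0 ≤ m x) (h1 : ∀ x, m x ≤ 1)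
    (ν : β → ℝ) (hν1 : ∑ y, ν y = 1) (ℬ : Set (β → ℝ))
    (hℬ : ∀ (k : ℕ) (g : Fin k → β → ℝ), (∀ j, g j ∈ ℬ) → 0 ≤ sahiE ν k g)
    {n : ℕ} (φ : Fin n → Finset ι₁ → ℝ) (ψ : Fin n → β → ℝ) (hφ : ∀ i, IsCumulation (φ i))
    (hψ : ∀ i, ψ i ∈ insert (1 : β → ℝ) ℬ) :
    0 ≤ sahiE (fun q : Finset ι₁ × β => finsetProdWeight m q.1 * ν q.2) n (fun i q => φ i q.1 * ψ i q.2) :=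
  SahiIndependentProducts.sahiE_prodWeight_nonneg_of_classes (finsetProdWeight m) ν (sum_finsetProdWeight m) hν1
    {f | IsCumulation f} (insert (1 : β → ℝ) ℬ) isCumulation_one (fun _ hf _ hg => isCumulation_mul hf hg)
    (fun k f hf => sahi2008_thm2 m h0 h1 k f hf) (sahiE_nonneg_of_forall_mem_insert_one ν hν1 ℬ hℬ) φ ψ hφ hψ

omit [Fintype β] in
/-- Splitting a union family into product form (plumbing): `append (φ∘fst) (g∘snd) = append φ 1 · append 1 g`. [folklore] -/
theorem append_eq_mul {α : Type*} {k l : ℕ} (φ : Fin k → α → ℝ) (g : Fin l → β → ℝ) :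
    (Fin.append (fun i (q : α × β) => φ i q.1) (fun j q => g j q.2) : Fin (k + l) → α × β → ℝ) =
      fun i q => (Fin.append φ (fun _ => (1 : α → ℝ)) : Fin (k + l) → α → ℝ) i q.1 *
        (Fin.append (fun _ => (1 : β → ℝ)) g : Fin (k + l) → β → ℝ) i q.2 := by
  funext i q
  refine Fin.addCases (fun i' => ?_) (fun j => ?_) i
  · simp only [Fin.append_left, Pi.one_apply, mul_one]
  · simp only [Fin.append_right, Pi.one_apply, one_mul]

/-- **Union form.**  `k` cumulations `φ_0,…,φ_{k−1}` read on the first factor and an `ℬ`-family `g_0,…,g_{l−1}` read on the second: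
`E_{k+l}(φ, g) ≥ 0` under the product weight. [cite: Sahi2008, Thm. 2 (p. 211), Prop. 12 (p. 219)] -/
theorem sahiE_prodWeight_cumulation_union_nonneg (m : ι₁ → ℝ) (h0 : ∀ x, 0 ≤ m x) (h1 : ∀ x, m x ≤ 1)
    (ν : β → ℝ) (hν1 : ∑ y, ν y = 1) (ℬ : Set (β → ℝ))
    (hℬ : ∀ (k : ℕ) (g : Fin k → β → ℝ), (∀ j, g j ∈ ℬ) → 0 ≤ sahiE ν k g)
    {k l : ℕ} (φ : Fin k → Finset ι₁ → ℝ) (hφ : ∀ i, IsCumulation (φ i)) (g : Fin l → β → ℝ) (hg : ∀ j, g j ∈ ℬ) :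
    0 ≤ sahiE (fun q : Finset ι₁ × β => finsetProdWeight m q.1 * ν q.2) (k + l)
      (Fin.append (fun i q => φ i q.1) (fun j q => g j q.2)) := by
  rw [append_eq_mul]
  refine sahiE_prodWeight_nonneg_of_cumulation_of_class m h0 h1 ν hν1 ℬ hℬ _ _ (fun i => ?_) (fun i => ?_)
  · refine Fin.addCases (fun i' => ?_) (fun j => ?_) i
    · rw [Fin.append_left]; exact hφ i'
    · rw [Fin.append_right]; exact isCumulation_one
  · refine Fin.addCases (fun i' => ?_) (fun j => ?_) i
    · rw [Fin.append_left]; exact Set.mem_insert _ _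
    · rw [Fin.append_right]; exact Set.mem_insert_of_mem _ (hg j)

end Cumulation

/-! ## Part 2.  A chain on the first factor (Blinovsky's lemma) -/

section Chain

variable {α : Type*} [Fintype α] [LinearOrder α] {β : Type*} [Fintype β]

/-- **Nonnegative monotone functions on a chain join independently to any hereditarily Sahi-positive class, at every order.**
`μ` ANY probability weight on a finite chain `α`, `ν` a probability weight on `β`, `ℬ` hereditarily Sahi-nonnegative under `ν`:
every family of products `φ_i(x)ψ_i(y)` with `φ_i ≥ 0` monotone and `ψ_i ∈ ℬ ∪ {1}` has `E_n ≥ 0` under `μ ⊗ ν`.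
[cite: Blinovsky2013FormalSeries, Lemma 1; Sahi2008, Prop. 12 (p. 219)] -/
theorem sahiE_prodWeight_nonneg_of_chain_of_class (μ : α → ℝ) (hμ0 : ∀ x, 0 ≤ μ x) (hμ1 : ∑ x, μ x = 1)
    (ν : β → ℝ) (hν1 : ∑ y, ν y = 1) (ℬ : Set (β → ℝ))
    (hℬ : ∀ (k : ℕ) (g : Fin k → β → ℝ), (∀ j, g j ∈ ℬ) → 0 ≤ sahiE ν k g)
    {n : ℕ} (φ : Fin n → α → ℝ) (ψ : Fin n → β → ℝ) (hφ0 : ∀ i x, 0 ≤ φ i x) (hφm : ∀ i, Monotone (φ i))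
    (hψ : ∀ i, ψ i ∈ insert (1 : β → ℝ) ℬ) :
    0 ≤ sahiE (fun q : α × β => μ q.1 * ν q.2) n (fun i q => φ i q.1 * ψ i q.2) := by
  refine SahiIndependentProducts.sahiE_prodWeight_nonneg_of_classes μ ν hμ1 hν1
    {f | (∀ x, 0 ≤ f x) ∧ Monotone f} (insert (1 : β → ℝ) ℬ) ⟨fun _ => zero_le_one, monotone_const⟩
    (fun f hf f' hf' => ⟨fun x => mul_nonneg (hf.1 x) (hf'.1 x), fun a b hab => ?_⟩)
    (fun k f hf => sahiPositive_of_linearOrder hμ0 hμ1 k f (fun i => (hf i).1) (fun i => (hf i).2))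
    (sahiE_nonneg_of_forall_mem_insert_one ν hν1 ℬ hℬ) φ ψ (fun i => ⟨hφ0 i, hφm i⟩) hψ
  exact mul_le_mul (hf.2 hab) (hf'.2 hab) (hf'.1 a) (hf.1 b)

/-- **Union form on a chain.**  `E_{k+l}(φ_0,…,φ_{k−1}, g_0,…,g_{l−1}) ≥ 0` for nonnegative monotone `φ_i` on the chain (first factor)
and an `ℬ`-family `g` (second factor). [cite: Blinovsky2013FormalSeries, Lemma 1; Sahi2008, Prop. 12 (p. 219)] -/
theorem sahiE_prodWeight_chain_union_nonneg (μ : α → ℝ) (hμ0 : ∀ x, 0 ≤ μ x) (hμ1 : ∑ x, μ x = 1)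
    (ν : β → ℝ) (hν1 : ∑ y, ν y = 1) (ℬ : Set (β → ℝ))
    (hℬ : ∀ (k : ℕ) (g : Fin k → β → ℝ), (∀ j, g j ∈ ℬ) → 0 ≤ sahiE ν k g)
    {k l : ℕ} (φ : Fin k → α → ℝ) (hφ0 : ∀ i x, 0 ≤ φ i x) (hφm : ∀ i, Monotone (φ i))
    (g : Fin l → β → ℝ) (hg : ∀ j, g j ∈ ℬ) :
    0 ≤ sahiE (fun q : α × β => μ q.1 * ν q.2) (k + l) (Fin.append (fun i q => φ i q.1) (fun j q => g j q.2)) := by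
  rw [append_eq_mul]
  refine sahiE_prodWeight_nonneg_of_chain_of_class μ hμ0 hμ1 ν hν1 ℬ hℬ _ _ (fun i => ?_) (fun i => ?_) (fun i => ?_)
  · refine Fin.addCases (fun i' x => ?_) (fun j x => ?_) i
    · rw [Fin.append_left]; exact hφ0 i' x
    · rw [Fin.append_right]; exact zero_le_one
  · refine Fin.addCases (fun i' => ?_) (fun j => ?_) i
    · rw [Fin.append_left]; exact hφm i'
    · rw [Fin.append_right]; exact monotone_const
  · refine Fin.addCases (fun i' => ?_) (fun j => ?_) i
    · rw [Fin.append_left]; exact Set.mem_insert _ _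
    · rw [Fin.append_right]; exact Set.mem_insert_of_mem _ (hg j)

end Chain

/-! ## Part 3.  Percolation: cylinder events ∪ width-≤5 hitting events on disjoint coordinates -/

section Hitting

open SahiHitting SahiIndependentPairJoin

variable {ι₁ ι₂ : Type*} [Fintype ι₁] [DecidableEq ι₁] [Fintype ι₂] [DecidableEq ι₂]

/-- **Cylinders and hitting events of two independent percolation models, every order.**  `m : ι₁ → [0,1]` the densities of a
product measure on `2^{ι₁}` (configurations as `Finset ι₁`), `p₂` a product-Bernoulli model on `ι₂`; `S_0,…,S_{k−1} ⊆ ι₁` ARBITRARY;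
`C` a width-≤5 collection of subsets of `ι₂` (among any six, two nested) and `c : Fin l → κ` any assignment.  Then the family of
cylinder events `{T : S_i ⊆ T}` ("every site of `S_i` is open", read on the first factor) and hitting events `H_{C(c j)}` (second
factor) has `E_{k+l} ≥ 0` under the product of the two models.
[cite: Sahi2008, Thm. 2 (p. 211), Prop. 12 (p. 219)] -/
theorem prodWeight_sahiE_cylinder_union_hit_nonneg (m : ι₁ → ℝ) (h0 : ∀ x, 0 ≤ m x) (h1 : ∀ x, m x ≤ 1)
    (p₂ : ι₂ → unitInterval) {k : ℕ} (S : Fin k → Finset ι₁) {κ : Type*} (C : κ → Finset ι₂)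
    (hC : ∀ T : Finset κ, T.card = 6 → ∃ a ∈ T, ∃ b ∈ T, a ≠ b ∧ C a ⊆ C b) {l : ℕ} (c : Fin l → κ) :
    0 ≤ sahiE (fun q : Finset ι₁ × Set ι₂ => finsetProdWeight m q.1 * bernoulliWeight p₂ q.2) (k + l)
      (Fin.append (fun i q => if S i ⊆ q.1 then (1 : ℝ) else 0)
        (fun j q => ind {ω : Set ι₂ | ∃ a ∈ C (c j), a ∈ ω} q.2)) :=
  sahiE_prodWeight_cumulation_union_nonneg m h0 h1 (bernoulliWeight p₂) (sum_bernoulliWeight p₂)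
    (Set.range fun k => ind {ω : Set ι₂ | ∃ a ∈ C k, a ∈ ω}) (sahiE_nonneg_of_mem_hitClass p₂ C hC)
    (fun i T => if S i ⊆ T then (1 : ℝ) else 0) (fun i => isCumulation_indicator_supset (S i))
    (fun j => ind {ω : Set ι₂ | ∃ a ∈ C (c j), a ∈ ω}) fun j => ⟨c j, rfl⟩

/-- **At most five hitting sets, arbitrary multiplicities, arbitrary cylinders.** [cite: Sahi2008, Thm. 2 (p. 211), Prop. 12 (p. 219)] -/
theorem prodWeight_sahiE_cylinder_union_hit_nonneg_of_card_le_five (m : ι₁ → ℝ) (h0 : ∀ x, 0 ≤ m x) (h1 : ∀ x, m x ≤ 1)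
    (p₂ : ι₂ → unitInterval) {k : ℕ} (S : Fin k → Finset ι₁) {κ : Type*} [Fintype κ] (hκ : Fintype.card κ ≤ 5)
    (C : κ → Finset ι₂) {l : ℕ} (c : Fin l → κ) :
    0 ≤ sahiE (fun q : Finset ι₁ × Set ι₂ => finsetProdWeight m q.1 * bernoulliWeight p₂ q.2) (k + l)
      (Fin.append (fun i q => if S i ⊆ q.1 then (1 : ℝ) else 0)
        (fun j q => ind {ω : Set ι₂ | ∃ a ∈ C (c j), a ∈ ω} q.2)) := by
  refine prodWeight_sahiE_cylinder_union_hit_nonneg m h0 h1 p₂ S C (fun T hT => ?_) c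
  have : T.card ≤ Fintype.card κ := Finset.card_le_univ T
  omega

/-- **General cumulations on the first factor** (nonnegative combinations of cylinder events, e.g. the number of fully open
sets among `S_1,…,S_r`, or products of such): with hitting events of a width-≤5 collection on the second factor, every order.
[cite: Sahi2008, Thm. 2 (p. 211), Prop. 12 (p. 219)] -/
theorem prodWeight_sahiE_cumulation_union_hit_nonneg (m : ι₁ → ℝ) (h0 : ∀ x, 0 ≤ m x) (h1 : ∀ x, m x ≤ 1)
    (p₂ : ι₂ → unitInterval) {k : ℕ} (φ : Fin k → Finset ι₁ → ℝ) (hφ : ∀ i, IsCumulation (φ i)) {κ : Type*}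
    (C : κ → Finset ι₂) (hC : ∀ T : Finset κ, T.card = 6 → ∃ a ∈ T, ∃ b ∈ T, a ≠ b ∧ C a ⊆ C b) {l : ℕ} (c : Fin l → κ) :
    0 ≤ sahiE (fun q : Finset ι₁ × Set ι₂ => finsetProdWeight m q.1 * bernoulliWeight p₂ q.2) (k + l)
      (Fin.append (fun i q => φ i q.1) (fun j q => ind {ω : Set ι₂ | ∃ a ∈ C (c j), a ∈ ω} q.2)) :=
  sahiE_prodWeight_cumulation_union_nonneg m h0 h1 (bernoulliWeight p₂) (sum_bernoulliWeight p₂)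
    (Set.range fun k => ind {ω : Set ι₂ | ∃ a ∈ C k, a ∈ ω}) (sahiE_nonneg_of_mem_hitClass p₂ C hC)
    φ hφ (fun j => ind {ω : Set ι₂ | ∃ a ∈ C (c j), a ∈ ω}) fun j => ⟨c j, rfl⟩

end Hitting

end SahiIndependentClassJoin

end Summit.CriticalPhenomena.PercolationContinuityZ3.Theorems
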